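/-
COR-CM (cell pub-hodgecm2, stage 2 of the Hodge ladder) — count-neutral kernel combinatorics (seat prover-pub-hodgecm2-b23-g40-0, binder
prover b23, gen 40; claim COMPLEMENT-FACES F2, HOME/INBOX.md l.9766; sequel of `Census/ComplementFacesWeight.lean`).  Bookkeeping
definitions with bodies (`lvl`, `sqPlaces`, `sq`, `squaresLE`) + theorems, in seat b09's intrinsic model (`CMF G c`, `rt`, `oflipCM`,
`gface`/`gfaceSet`, `pair`/`pairSet`, `translates`, `Block`/`blk`, `cplT` — consumed BY NAME, nothing restated); no certificate, no
`decide`, no named fact, no geometry, no `sorry`.  `Interfaces.lean` (C1), every E term, B01 and `Transposition/*` are untouched.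
HONEST FRAMING: `HC_CM` is NOT proved, here or anywhere in the tree; nothing here is a period or a headline.
-/
import Summits.HodgeConjecture.CorCM.Census.ComplementFacesWeight

/-!
# Faces of a complemented Galois CM type, II: the graded descent, the level of a type, the canonical squares

CONTENT (setting of part I: `G` finite, `c` a central involution, `A` a complement, `T = cplT` its CM type, `n = |A|`).
* §1 **A graded descent in `ℤ[types]`** (no `c`-hypothesis at all): if a submodule `L` contains, for every type `Ψ` of degree
  `1 ≤ deg Ψ ≤ K`, a relation `[Ψ] + w` whose remainder `w` is invisible in degree `≥ deg Ψ`, then every vector supported in degree `≤ K`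
  is congruent modulo `L` to one supported in degree `0` (`clear_step`, `descent`; the engine of the seat's gen-38 `CyclicFacesResidue`
  made generic).
* §2 **The level** `lvl T Ψ ∈ ℕ` of a type: `0` if `wt ≤ 1`; `2·wt` if `2 ≤ wt ≤ n − wt` (light); `2(n − wt) + 1` if `n − wt < wt`
  (heavy).  `lvl = 0 ↔ wt ≤ 1`, `lvl ≤ 2·cls + 1`; the conjugate of a heavy type has smaller level (`lvl_rt_self_lt`).
* §3 **The canonical squares**: for every block `B` of class `k ≥ 2` ONE face relation `sq B = gface ρ_B d d'` through two deviation
  places `d ≠ d'` of its normalised representative `ρ_B = nrep B` (other corners of weight `k − 1, k − 1, k − 2`); `squaresLE m` = the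
  squares of the blocks of class `2 ≤ k ≤ m`; they are face relations (`squaresLE_subset_gfaceSet`) and there are at most `β − 2` of them
  (`card_squaresLE_add_two_le`).
* §4 **The relations.**  Through every LIGHT type `Ψ` of weight `k ≥ 2` passes a base change of `sq (blk Ψ)` whose three other corners
  have class `≤ k − 1`, hence level `< lvl Ψ` (`exists_rel_light`); through every HEAVY type passes its pair (`exists_rel_heavy`).  Hence
  (**`exists_reduced`**) every vector supported in level `≤ 2m + 1` is congruent, modulo `ℤ⟨pairs⟩ ⊔ ℤ⟨base changes of squaresLE m⟩`, to a
  vector supported on the types of weight `≤ 1` (`T` and its single flips `T^{(d)}`, `d ∈ A`); with `m = n/2` this is every vector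
  (`exists_reduced_all`).  Parts III–IV identify the reduced Hodge vectors (multiples of the Weil vector) and close.
No commutativity of `A` is used.  All [folklore] bookkeeping over [Pohlmann1968, Thm 1] in the reading of [Milne1999, Prop. 2.1].

## References
* [Pohlmann1968] H. Pohlmann, Algebraic cycles on abelian varieties of complex multiplication type, Ann. of Math. 88 (1968), Thm 1.
* [Milne1999] J. S. Milne, Lefschetz motives and the Tate conjecture, Compositio Math. 117 (1999), Prop. 2.1, p. 54.
-/

namespace Summit.HodgeConjecture.CorCM.Census.ComplementFaces

open Finset
open scoped symmDiff
open Summit.HodgeConjecture.CorCM.Prior.AllgGroup.RfwfAllgGroup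
open Summit.HodgeConjecture.CorCM.Census.BlockParity
open Summit.HodgeConjecture.CorCM.Census.Coinvariant

noncomputable section

variable {G : Type*} [Group G] [Fintype G] [DecidableEq G] (c : G)

/-! ## §1 A graded descent in `ℤ[types]` -/

omit [Group G] in
/-- **One clearing step.**  If `L` holds, through every type of degree `K`, a relation `[Ψ] + w` with `w` invisible in degree `≥ K`,
then a vector supported in degree `≤ K` is congruent modulo `L` to one supported in degree `< K`. [folklore] -/
theorem clear_step {ι : Type*} (deg : ι → ℕ) (L : Submodule ℤ (ι →₀ ℤ)) (K : ℕ)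
    (hL : ∀ Ψ : ι, deg Ψ = K → ∃ v ∈ L, ∃ w : ι →₀ ℤ, (∀ Φ, K ≤ deg Φ → w Φ = 0) ∧ v = Finsupp.single Ψ 1 + w)
    (y : ι →₀ ℤ) (hy : ∀ Ψ ∈ y.support, deg Ψ ≤ K) :
    ∃ y' : ι →₀ ℤ, y - y' ∈ L ∧ ∀ Ψ ∈ y'.support, deg Ψ < K := by
  classical
  choose! F hFmem W hW hFeq using hL
  set B : Finset ι := y.support.filter fun Ψ => deg Ψ = K with hB
  set q : ι →₀ ℤ := ∑ Ψ ∈ B, y Ψ • F Ψ with hq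
  have hqmem : q ∈ L := Submodule.sum_mem _ fun Ψ hΨ => Submodule.smul_mem _ _ (hFmem Ψ (mem_filter.mp hΨ).2)
  have hqval : ∀ Φ : ι, K ≤ deg Φ → q Φ = if Φ ∈ B then y Φ else 0 := by
    intro Φ hΦ
    rw [hq, Finsupp.finsetSum_apply]
    have hterm : ∀ Ψ ∈ B, (y Ψ • F Ψ) Φ = if Φ = Ψ then y Ψ else 0 := by
      intro Ψ hΨ
      have hK : deg Ψ = K := (mem_filter.mp hΨ).2
      rw [Finsupp.smul_apply, smul_eq_mul, hFeq Ψ hK, Finsupp.add_apply, hW Ψ hK Φ hΦ, add_zero, Finsupp.single_apply]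
      by_cases h : Ψ = Φ
      · rw [if_pos h, if_pos h.symm, mul_one]
      · rw [if_neg h, if_neg (Ne.symm h), mul_zero]
    rw [sum_congr rfl hterm, sum_ite_eq]
  refine ⟨y - q, by rw [sub_sub_cancel]; exact hqmem, fun Φ hΦ => ?_⟩
  by_contra hbad
  have hbad' : K ≤ deg Φ := not_lt.mp hbad
  rw [Finsupp.mem_support_iff, Finsupp.sub_apply, hqval Φ hbad'] at hΦ
  by_cases hB' : Φ ∈ B
  · rw [if_pos hB', sub_self] at hΦ; exact hΦ rfl
  · rw [if_neg hB', sub_zero] at hΦ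
    have hsupp : Φ ∈ y.support := Finsupp.mem_support_iff.mpr hΦ
    exact hB' (mem_filter.mpr ⟨hsupp, le_antisymm (hy Φ hsupp) hbad'⟩)

omit [Group G] in
/-- **THE GRADED DESCENT.**  If `L` holds such a relation through every type of degree `1 ≤ deg ≤ K`, then every vector supported in
degree `≤ K` is congruent modulo `L` to one supported in degree `0`. [folklore] -/
theorem descent {ι : Type*} (deg : ι → ℕ) (L : Submodule ℤ (ι →₀ ℤ)) (K : ℕ)
    (hL : ∀ Ψ : ι, 1 ≤ deg Ψ → deg Ψ ≤ K →
      ∃ v ∈ L, ∃ w : ι →₀ ℤ, (∀ Φ, deg Ψ ≤ deg Φ → w Φ = 0) ∧ v = Finsupp.single Ψ 1 + w)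
    (y : ι →₀ ℤ) (hy : ∀ Ψ ∈ y.support, deg Ψ ≤ K) :
    ∃ y' : ι →₀ ℤ, y - y' ∈ L ∧ ∀ Ψ ∈ y'.support, deg Ψ = 0 := by
  induction K generalizing y with
  | zero => exact ⟨y, by rw [sub_self]; exact L.zero_mem, fun Ψ h => Nat.le_zero.mp (hy Ψ h)⟩
  | succ K ih =>
    have hK : ∀ Ψ : ι, deg Ψ = K + 1 → ∃ v ∈ L, ∃ w : ι →₀ ℤ, (∀ Φ, K + 1 ≤ deg Φ → w Φ = 0) ∧ v = Finsupp.single Ψ 1 + w := by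
      intro Ψ hΨ
      obtain ⟨v, hv, w, hw, hvw⟩ := hL Ψ (by omega) (le_of_eq hΨ)
      exact ⟨v, hv, w, fun Φ hΦ => hw Φ (by rw [hΨ]; exact hΦ), hvw⟩
    obtain ⟨y₁, h₁, hy₁⟩ := clear_step deg L (K + 1) hK y hy
    obtain ⟨y₂, h₂, hy₂⟩ := ih (fun Ψ h1 hle => hL Ψ h1 (by omega)) y₁ (fun Ψ h => Nat.lt_succ_iff.mp (hy₁ Ψ h))
    exact ⟨y₂, by rw [show y - y₂ = (y - y₁) + (y₁ - y₂) from by abel]; exact L.add_mem h₁ h₂, hy₂⟩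

/-! ## §2 The level of a type -/

/-- **The level** of a type relative to the base type `T` (`n = |T|`): `0` if `wt ≤ 1`, `2·wt` if light (`2 ≤ wt ≤ n − wt`),
`2(n − wt) + 1` if heavy (`n − wt < wt`). [folklore] -/
def lvl (T Ψ : CMF G c) : ℕ :=
  if wt c T Ψ ≤ 1 then 0 else if wt c T Ψ ≤ T.1.card - wt c T Ψ then 2 * wt c T Ψ else 2 * (T.1.card - wt c T Ψ) + 1

/-- Level `0` means weight `≤ 1`. [folklore] -/
theorem lvl_eq_zero_iff (T Ψ : CMF G c) : lvl c T Ψ = 0 ↔ wt c T Ψ ≤ 1 := by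
  unfold lvl
  by_cases h1 : wt c T Ψ ≤ 1
  · rw [if_pos h1]; exact ⟨fun _ => h1, fun _ => rfl⟩
  · rw [if_neg h1]
    refine ⟨fun h => ?_, fun h => absurd h h1⟩
    exfalso
    by_cases h2 : wt c T Ψ ≤ T.1.card - wt c T Ψ
    · rw [if_pos h2] at h; omega
    · rw [if_neg h2] at h; omega

/-- Positive level means weight `≥ 2`. [folklore] -/
theorem two_le_wt_of_lvl {T Ψ : CMF G c} (h : 1 ≤ lvl c T Ψ) : 2 ≤ wt c T Ψ := by
  unfold lvl at h; split_ifs at h <;> omega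

/-- The level of a light type of weight `≥ 2`. [folklore] -/
theorem lvl_of_light {T Ψ : CMF G c} (h2 : 2 ≤ wt c T Ψ) (hl : wt c T Ψ ≤ T.1.card - wt c T Ψ) : lvl c T Ψ = 2 * wt c T Ψ := by
  unfold lvl; rw [if_neg (by omega), if_pos hl]

/-- The level of a heavy type of weight `≥ 2`. [folklore] -/
theorem lvl_of_heavy {T Ψ : CMF G c} (h2 : 2 ≤ wt c T Ψ) (hh : T.1.card - wt c T Ψ < wt c T Ψ) :
    lvl c T Ψ = 2 * (T.1.card - wt c T Ψ) + 1 := by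
  unfold lvl; rw [if_neg (by omega), if_neg (by omega)]

/-- **The level is at most `2·class + 1`.** [folklore] -/
theorem lvl_le (T Ψ : CMF G c) : lvl c T Ψ ≤ 2 * cls c T Ψ + 1 := by
  unfold lvl cls
  rw [Nat.min_def]
  split_ifs <;> omega

/-- Every level is at most `2·(n/2) + 1`. [folklore] -/
theorem lvl_le_card (T Ψ : CMF G c) : lvl c T Ψ ≤ 2 * (T.1.card / 2) + 1 := by
  have h1 := lvl_le c T Ψ
  have h2 := two_mul_cls_le c T Ψ
  omega

/-- **The conjugate of a heavy type of weight `≥ 2` has smaller level** (central `c`). [folklore] -/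
theorem lvl_rt_self_lt (hcen : ∀ x : G, x * c = c * x) {T Ψ : CMF G c} (h2 : 2 ≤ wt c T Ψ)
    (hh : T.1.card - wt c T Ψ < wt c T Ψ) : lvl c T (rt c c Ψ) < lvl c T Ψ := by
  rw [lvl_of_heavy c h2 hh]
  have hw : wt c T (rt c c Ψ) = T.1.card - wt c T Ψ := wt_rt_self c hcen T Ψ
  have hle := wt_le c T Ψ
  unfold lvl
  split_ifs <;> omega

/-! ## §3 The canonical squares -/

section Complement

variable {A : Subgroup G} (hA : ∀ x : G, x ∈ A ↔ c * x ∉ A)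

/-- A block of class `≥ 2` has two distinct deviation places at its normalised representative. [folklore] -/
theorem exists_sqPlaces (hcen : ∀ x : G, x * c = c * x) (B : Block c) (hB : 2 ≤ bcls c hA B) :
    ∃ p : G × G, p.1 ∈ (cplT c A hA).1 ∧ p.1 ∉ (nrep c hA hcen B).1 ∧ p.2 ∈ (cplT c A hA).1 ∧ p.2 ∉ (nrep c hA hcen B).1 ∧
      p.1 ≠ p.2 := by
  obtain ⟨d, d', hd, hdρ, hd', hd'ρ, hne⟩ := exists_two_devs c (T := cplT c A hA) (Ψ := nrep c hA hcen B)
    (by rw [wt_nrep]; exact hB)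
  exact ⟨(d, d'), hd, hdρ, hd', hd'ρ, hne⟩

/-- **The two deviation places** of the canonical square of a block (a choice; junk `(1, 1)` for class `≤ 1`). [folklore] -/
def sqPlaces (hcen : ∀ x : G, x * c = c * x) (B : Block c) : G × G :=
  if hB : 2 ≤ bcls c hA B then (exists_sqPlaces c hA hcen B hB).choose else (1, 1)

/-- The chosen places are distinct deviation places of the normalised representative. [folklore] -/
theorem sqPlaces_spec (hcen : ∀ x : G, x * c = c * x) {B : Block c} (hB : 2 ≤ bcls c hA B) :
    (sqPlaces c hA hcen B).1 ∈ (cplT c A hA).1 ∧ (sqPlaces c hA hcen B).1 ∉ (nrep c hA hcen B).1 ∧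
      (sqPlaces c hA hcen B).2 ∈ (cplT c A hA).1 ∧ (sqPlaces c hA hcen B).2 ∉ (nrep c hA hcen B).1 ∧
      (sqPlaces c hA hcen B).1 ≠ (sqPlaces c hA hcen B).2 := by
  unfold sqPlaces
  rw [dif_pos hB]
  exact (exists_sqPlaces c hA hcen B hB).choose_spec

/-- **The canonical square** of a block: the face relation through two deviation places of its normalised representative. [folklore] -/
def sq (hc2 : c * c = 1) (hcen : ∀ x : G, x * c = c * x) (B : Block c) : CMF G c →₀ ℤ :=
  gface c hc2 (nrep c hA hcen B) (sqPlaces c hA hcen B).1 (sqPlaces c hA hcen B).2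

/-- **The canonical squares of the blocks of class `2 ≤ k ≤ m`.** [folklore] -/
def squaresLE (hc2 : c * c = 1) (hcen : ∀ x : G, x * c = c * x) (m : ℕ) : Finset (CMF G c →₀ ℤ) :=
  (univ.filter fun B : Block c => 2 ≤ bcls c hA B ∧ bcls c hA B ≤ m).image (sq c hA hc2 hcen)

/-- The square of a block of class `2 ≤ k ≤ m` belongs to `squaresLE m`. [folklore] -/
theorem sq_mem_squaresLE (hc2 : c * c = 1) (hcen : ∀ x : G, x * c = c * x) {m : ℕ} {B : Block c} (hB : 2 ≤ bcls c hA B)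
    (hBm : bcls c hA B ≤ m) : sq c hA hc2 hcen B ∈ squaresLE c hA hc2 hcen m :=
  mem_image.mpr ⟨B, mem_filter.mpr ⟨mem_univ _, hB, hBm⟩, rfl⟩

/-- `squaresLE` is monotone in the class bound. [folklore] -/
theorem squaresLE_mono (hc2 : c * c = 1) (hcen : ∀ x : G, x * c = c * x) {m m' : ℕ} (h : m ≤ m') :
    squaresLE c hA hc2 hcen m ⊆ squaresLE c hA hc2 hcen m' := by
  intro s hs
  obtain ⟨B, hB, rfl⟩ := mem_image.mp hs
  obtain ⟨-, hB2, hBm⟩ := mem_filter.mp hB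
  exact sq_mem_squaresLE c hA hc2 hcen hB2 (hBm.trans h)

/-- The canonical square of a block of class `≥ 2` is a face relation (its two places are distinct places). [folklore] -/
theorem sq_mem_gfaceSet (hc2 : c * c = 1) (hcen : ∀ x : G, x * c = c * x) {B : Block c} (hB : 2 ≤ bcls c hA B) :
    sq c hA hc2 hcen B ∈ gfaceSet G c hc2 := by
  obtain ⟨hd, -, hd', -, hne⟩ := sqPlaces_spec c hA hcen hB
  exact ⟨_, _, _, notMem_orb_of_mem c hd hd' hne.symm, rfl⟩

/-- **The canonical squares are face relations.** [folklore] -/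
theorem squaresLE_subset_gfaceSet (hc2 : c * c = 1) (hcen : ∀ x : G, x * c = c * x) (m : ℕ) :
    (↑(squaresLE c hA hc2 hcen m) : Set (CMF G c →₀ ℤ)) ⊆ gfaceSet G c hc2 := by
  intro s hs
  obtain ⟨B, hB, rfl⟩ := mem_image.mp (mem_coe.mp hs)
  exact sq_mem_gfaceSet c hA hc2 hcen (mem_filter.mp hB).2.1

/-- **There are at most `β − 2` canonical squares** (`|A| ≥ 2`). [folklore] -/
theorem card_squaresLE_add_two_le (hc2 : c * c = 1) (hcen : ∀ x : G, x * c = c * x) (h2 : 2 ≤ (cplT c A hA).1.card) (m : ℕ) :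
    (squaresLE c hA hc2 hcen m).card + 2 ≤ Fintype.card (Block c) := by
  have h1 : (squaresLE c hA hc2 hcen m).card ≤ (univ.filter fun B : Block c => 2 ≤ bcls c hA B).card :=
    card_image_le.trans (card_le_card fun B hB => by
      rw [mem_filter] at hB ⊢; exact ⟨hB.1, hB.2.1⟩)
  have h3 := card_filter_two_le_bcls_add_two_le c hA hc2 hcen h2
  omega

/-- For `|A| = 1` there are no canonical squares. [folklore] -/
theorem squaresLE_eq_empty (hc2 : c * c = 1) (hcen : ∀ x : G, x * c = c * x) (h1 : (cplT c A hA).1.card = 1) (m : ℕ) :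
    squaresLE c hA hc2 hcen m = ∅ := by
  unfold squaresLE
  rw [image_eq_empty, filter_eq_empty_iff]
  intro B _ hB
  have := two_mul_bcls_le c hA B
  omega

/-! ## §4 The relations through light and heavy types, and the reduction to weight `≤ 1` -/

/-- Membership outside the flipped place is unchanged. [folklore] -/
theorem mem_oflipCM_iff_of_notMem_orb (hc2 : c * c = 1) {t x : G} (hx : x ∉ orb c t) (Ψ : CMF G c) :
    x ∈ (oflipCM c hc2 t Ψ).1 ↔ x ∈ Ψ.1 := by
  change x ∈ oflip c t Ψ.1 ↔ x ∈ Ψ.1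
  rw [oflip, mem_symmDiff]
  tauto

/-- **The weights of the three other corners of a canonical square**: `k − 1`, `k − 1`, `k − 2` (`k` the class of the block).
[folklore] -/
theorem wt_corners_sq (hc2 : c * c = 1) (hcen : ∀ x : G, x * c = c * x) {B : Block c} (hB : 2 ≤ bcls c hA B) :
    wt c (cplT c A hA) (oflipCM c hc2 (sqPlaces c hA hcen B).1 (nrep c hA hcen B)) + 1 = bcls c hA B ∧
      wt c (cplT c A hA) (oflipCM c hc2 (sqPlaces c hA hcen B).2 (nrep c hA hcen B)) + 1 = bcls c hA B ∧
      wt c (cplT c A hA) (oflipCM c hc2 (sqPlaces c hA hcen B).1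
        (oflipCM c hc2 (sqPlaces c hA hcen B).2 (nrep c hA hcen B))) + 2 = bcls c hA B := by
  obtain ⟨hd, hdρ, hd', hd'ρ, hne⟩ := sqPlaces_spec c hA hcen hB
  have hρ := wt_nrep c hA hcen B
  refine ⟨by rw [← hρ]; exact wt_oflipCM_of_notMem c hc2 hd hdρ, by rw [← hρ]; exact wt_oflipCM_of_notMem c hc2 hd' hd'ρ, ?_⟩
  have hdρ' : (sqPlaces c hA hcen B).1 ∉ (oflipCM c hc2 (sqPlaces c hA hcen B).2 (nrep c hA hcen B)).1 := by
    rw [mem_oflipCM_iff_of_notMem_orb c hc2 (notMem_orb_of_mem c hd' hd hne)]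
    exact hdρ
  have h1 := wt_oflipCM_of_notMem c hc2 (Ψ := oflipCM c hc2 (sqPlaces c hA hcen B).2 (nrep c hA hcen B)) hd hdρ'
  have h2 := wt_oflipCM_of_notMem c hc2 (Ψ := nrep c hA hcen B) hd' hd'ρ
  omega

/-- **The relation through a LIGHT type of weight `2 ≤ k ≤ m`**: a base change of the canonical square of its block, `[Ψ] + w` with
`w` supported on three types of class `≤ k − 1`, hence of level `< lvl Ψ = 2k`. [folklore] -/
theorem exists_rel_light (hc2 : c * c = 1) (hcen : ∀ x : G, x * c = c * x) {m : ℕ} (Ψ : CMF G c)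
    (h2 : 2 ≤ wt c (cplT c A hA) Ψ) (hl : wt c (cplT c A hA) Ψ ≤ (cplT c A hA).1.card - wt c (cplT c A hA) Ψ)
    (hm : wt c (cplT c A hA) Ψ ≤ m) :
    ∃ v ∈ Submodule.span ℤ (translates c (squaresLE c hA hc2 hcen m)), ∃ w : CMF G c →₀ ℤ,
      (∀ Φ, lvl c (cplT c A hA) Ψ ≤ lvl c (cplT c A hA) Φ → w Φ = 0) ∧ v = Finsupp.single Ψ 1 + w := by
  have hcls : cls c (cplT c A hA) Ψ = wt c (cplT c A hA) Ψ := cls_eq_wt_of_le c hl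
  have hB : bcls c hA (blk c Ψ) = wt c (cplT c A hA) Ψ := by rw [← cls_eq_bcls c hA hc2 hcen, hcls]
  have hB2 : 2 ≤ bcls c hA (blk c Ψ) := by omega
  obtain ⟨Q, hQ⟩ := exists_rt_nrep_eq c hA hcen Ψ
  obtain ⟨hw₁, hw₂, hw₃⟩ := wt_corners_sq c hA hc2 hcen hB2
  have hlvlΨ : lvl c (cplT c A hA) Ψ = 2 * wt c (cplT c A hA) Ψ := lvl_of_light c h2 hl
  -- a type of class `≤ k − 1` has level `< lvl Ψ`
  have hlow : ∀ X : CMF G c, cls c (cplT c A hA) X + 1 ≤ wt c (cplT c A hA) Ψ →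
      ¬ lvl c (cplT c A hA) Ψ ≤ lvl c (cplT c A hA) X := by
    intro X hX hle
    have := lvl_le c (cplT c A hA) X
    omega
  refine ⟨Finsupp.mapDomain (rt c Q) (sq c hA hc2 hcen (blk c Ψ)),
    Submodule.subset_span ⟨Q, _, sq_mem_squaresLE c hA hc2 hcen hB2 (by omega), rfl⟩,
    Finsupp.mapDomain (rt c Q) (sq c hA hc2 hcen (blk c Ψ)) - Finsupp.single Ψ 1, fun Φ hΦ => ?_, by abel⟩
  rw [sq, gface]
  simp only [Finsupp.mapDomain_add, Finsupp.mapDomain_sub, Finsupp.mapDomain_single, hQ]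
  -- the three other corners, moved to `Ψ` by the base change `Q`, have class `≤ k − 1`
  set X₁ := rt c Q (oflipCM c hc2 (sqPlaces c hA hcen (blk c Ψ)).1 (nrep c hA hcen (blk c Ψ))) with hX₁
  set X₂ := rt c Q (oflipCM c hc2 (sqPlaces c hA hcen (blk c Ψ)).2 (nrep c hA hcen (blk c Ψ))) with hX₂
  set X₃ := rt c Q (oflipCM c hc2 (sqPlaces c hA hcen (blk c Ψ)).1
    (oflipCM c hc2 (sqPlaces c hA hcen (blk c Ψ)).2 (nrep c hA hcen (blk c Ψ)))) with hX₃
  have hc₁ : cls c (cplT c A hA) X₁ + 1 ≤ wt c (cplT c A hA) Ψ := by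
    rw [hX₁, cls_rt c hA hc2 hcen]
    have := cls_le_wt c (cplT c A hA) (oflipCM c hc2 (sqPlaces c hA hcen (blk c Ψ)).1 (nrep c hA hcen (blk c Ψ)))
    omega
  have hc₂ : cls c (cplT c A hA) X₂ + 1 ≤ wt c (cplT c A hA) Ψ := by
    rw [hX₂, cls_rt c hA hc2 hcen]
    have := cls_le_wt c (cplT c A hA) (oflipCM c hc2 (sqPlaces c hA hcen (blk c Ψ)).2 (nrep c hA hcen (blk c Ψ)))
    omega
  have hc₃ : cls c (cplT c A hA) X₃ + 1 ≤ wt c (cplT c A hA) Ψ := by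
    rw [hX₃, cls_rt c hA hc2 hcen]
    have := cls_le_wt c (cplT c A hA) (oflipCM c hc2 (sqPlaces c hA hcen (blk c Ψ)).1
      (oflipCM c hc2 (sqPlaces c hA hcen (blk c Ψ)).2 (nrep c hA hcen (blk c Ψ))))
    omega
  have n1 : X₁ ≠ Φ := by rintro rfl; exact hlow _ hc₁ hΦ
  have n2 : X₂ ≠ Φ := by rintro rfl; exact hlow _ hc₂ hΦ
  have n3 : X₃ ≠ Φ := by rintro rfl; exact hlow _ hc₃ hΦ
  simp only [Finsupp.sub_apply, Finsupp.add_apply, Finsupp.single_apply, if_neg n1, if_neg n2, if_neg n3]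
  split_ifs <;> simp

/-- **The relation through a HEAVY type of weight `≥ 2`**: its pair `[Ψ] + [Ψ·c]`, the conjugate having smaller level. [folklore] -/
theorem exists_rel_heavy (hcen : ∀ x : G, x * c = c * x) (T Ψ : CMF G c) (h2 : 2 ≤ wt c T Ψ)
    (hh : T.1.card - wt c T Ψ < wt c T Ψ) :
    ∃ v ∈ Submodule.span ℤ (pairSet c), ∃ w : CMF G c →₀ ℤ,
      (∀ Φ, lvl c T Ψ ≤ lvl c T Φ → w Φ = 0) ∧ v = Finsupp.single Ψ 1 + w := by
  refine ⟨pair c Ψ, Submodule.subset_span (pair_mem_pairSet c Ψ), Finsupp.single (rt c c Ψ) 1, fun Φ hΦ => ?_, rfl⟩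
  have hne : rt c c Ψ ≠ Φ := by
    rintro rfl
    exact absurd hΦ (not_le.mpr (lvl_rt_self_lt c hcen h2 hh))
  rw [Finsupp.single_apply, if_neg hne]

/-- **The relation through every type of level `1 ≤ lvl ≤ 2m + 1`**, inside `ℤ⟨pairs⟩ ⊔ ℤ⟨base changes of squaresLE m⟩`. [folklore] -/
theorem exists_rel (hc2 : c * c = 1) (hcen : ∀ x : G, x * c = c * x) (m : ℕ) (Ψ : CMF G c)
    (h1 : 1 ≤ lvl c (cplT c A hA) Ψ) (hm : lvl c (cplT c A hA) Ψ ≤ 2 * m + 1) :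
    ∃ v ∈ Submodule.span ℤ (pairSet c) ⊔ Submodule.span ℤ (translates c (squaresLE c hA hc2 hcen m)), ∃ w : CMF G c →₀ ℤ,
      (∀ Φ, lvl c (cplT c A hA) Ψ ≤ lvl c (cplT c A hA) Φ → w Φ = 0) ∧ v = Finsupp.single Ψ 1 + w := by
  have h2 : 2 ≤ wt c (cplT c A hA) Ψ := two_le_wt_of_lvl c h1
  by_cases hl : wt c (cplT c A hA) Ψ ≤ (cplT c A hA).1.card - wt c (cplT c A hA) Ψ
  · have hlv := lvl_of_light c h2 hl
    obtain ⟨v, hv, w, hw, hvw⟩ := exists_rel_light c hA hc2 hcen (m := m) Ψ h2 hl (by omega)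
    exact ⟨v, Submodule.mem_sup_right hv, w, hw, hvw⟩
  · obtain ⟨v, hv, w, hw, hvw⟩ := exists_rel_heavy c hcen (cplT c A hA) Ψ h2 (not_le.mp hl)
    exact ⟨v, Submodule.mem_sup_left hv, w, hw, hvw⟩

/-- **THE REDUCTION TO WEIGHT `≤ 1`** (class-bounded form): a vector supported in level `≤ 2m + 1` is congruent, modulo
`ℤ⟨pairs⟩ ⊔ ℤ⟨base changes of the canonical squares of class ≤ m⟩`, to a vector supported on the types of weight `≤ 1`. [folklore] -/
theorem exists_reduced (hc2 : c * c = 1) (hcen : ∀ x : G, x * c = c * x) (m : ℕ) (y : CMF G c →₀ ℤ)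
    (hy : ∀ Ψ ∈ y.support, lvl c (cplT c A hA) Ψ ≤ 2 * m + 1) :
    ∃ y' : CMF G c →₀ ℤ, y - y' ∈ Submodule.span ℤ (pairSet c) ⊔ Submodule.span ℤ (translates c (squaresLE c hA hc2 hcen m)) ∧
      ∀ Ψ ∈ y'.support, wt c (cplT c A hA) Ψ ≤ 1 := by
  obtain ⟨y', hy', hsupp⟩ := descent (lvl c (cplT c A hA)) _ (2 * m + 1)
    (fun Ψ h1 hm => exists_rel c hA hc2 hcen m Ψ h1 hm) y hy
  exact ⟨y', hy', fun Ψ hΨ => (lvl_eq_zero_iff c _ Ψ).mp (hsupp Ψ hΨ)⟩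

/-- **THE REDUCTION TO WEIGHT `≤ 1`** (every vector; all canonical squares, `m = n/2`). [folklore] -/
theorem exists_reduced_all (hc2 : c * c = 1) (hcen : ∀ x : G, x * c = c * x) (y : CMF G c →₀ ℤ) :
    ∃ y' : CMF G c →₀ ℤ, y - y' ∈ Submodule.span ℤ (pairSet c) ⊔
        Submodule.span ℤ (translates c (squaresLE c hA hc2 hcen ((cplT c A hA).1.card / 2))) ∧
      ∀ Ψ ∈ y'.support, wt c (cplT c A hA) Ψ ≤ 1 :=
  exists_reduced c hA hc2 hcen _ y fun Ψ _ => lvl_le_card c _ Ψ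

end Complement

end

end Summit.HodgeConjecture.CorCM.Census.ComplementFaces
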